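import Summits.ABC.IUTFork.Cor312PilotIdelesPrArchThreshold
import Summits.ABC.IUTFork.ForkGenuineRegimes
import Summits.ABC.IUTFork.LDHPerPrimeReadingWitness
import Mathlib.Analysis.Complex.ExponentialBounds
import Mathlib.Analysis.Real.Pi.Bounds
import HarnessLib

/-!
# [IUTchIII] Corollary 3.12 at the FOURTH CORNER: TEAM B's region-volume input there IS the skeleton's SHALLOW REGIME
# (bridge `Cor312PilotIdelesPrArchThreshold` ↔ `ForkGenuineRegimes`), and both signs are inhabited along one depth family

PROOF-ONLY record file (D-0012; no definitions, no `Prop` facts) of the abc-iut cell (wave-5 prover seat abc-iut-w5-d163,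
gen 3 — the seat whose archimedean container MODEL `π^{j+1}·B_I` ([IUTchIV] Thm. 1.10 Step (vii)) defines the fourth corner
`Real.settingPrVolArchSharp`; delta named by the G-c312-11-1 row owner B1, 2026-08-26T09:53Z); TAKES NO SIDE on [IUTchIII] Cor. 3.12.

WHAT IS ALREADY IN THE TREE (consumed BY NAME, not restated): abc-iut-c312-7's `globalVolumeTransport_settingPrVolArchSharp_iff`
(TEAM B's input `GlobalVolumeTransport` at the fourth corner ⟺ `−deĝ̲(P_q) ≤ −deĝ̲_lgp(P_Θ) + PN(i ↦ |S^±_{i+2}|·log π)`);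
abc-iut-w5-d235's `processionNormalized_card_caps_mul` (`PN(i ↦ |S^±_{i+2}|·c) = ((ℓ⋇+3)/2)·c`) and abc-iut-w5-d241's
`globalVolumeTransport_settingPrVolArchSharp_iff_ndeg_qDivisor_le` (⟺ `deĝ̲(𝔮) ≤ 6l(l+5)/((l+4)(l−3))·log π`); and, on the
skeleton side, abc-iut-skel's `GenuineContent.cor312Of_of_shallow` (`ForkGenuineRegimes`: at a GENUINE Θ-volume input `I`,
`((l+1)/24 − 1/(2l))·deĝ̲(𝔮) ≤ ThetaVolumeInput.archLogTheta l ⟹ Cor312Of I` by the free inequality alone — the SHALLOW REGIME).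

WHAT THIS FILE ADDS (the bridge, as named kernel lemmas):
* §1 `archCornerIneq_iff_shallow` — the fourth-corner inequality ⟺ `((l+1)/24 − 1/(2l))·deĝ̲(𝔮) ≤ ThetaVolumeInput.archLogTheta l`,
  i.e. LITERALLY the hypothesis of `cor312Of_of_shallow` (the archimedean constant `PN(i ↦ |S^±_{i+2}|·log π)` IS abc-iut-S2's
  `archLogTheta l = ((l+5)/4)·log π`, `processionNormalized_card_caps_log_pi_eq_archLogTheta`).
* §2 **`globalVolumeTransport_settingPrVolArchSharp_iff_shallow`** — at the fourth corner, TEAM B's input ⟺ the shallow regime;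
  `statement_settingPrVolArchSharp_of_shallow` (shallow ⟹ the typed `Statement` there), `not_globalVolumeTransport_…_of_deep`.
* §3 **`cor312Of_of_globalVolumeTransport_settingPrVolArchSharp`** — for EVERY genuine Θ-volume input `I` (abc-iut-S2/S7
  `ThetaVolumeInput`, any section of places, any ideles) with pilot data `I.X = X`: TEAM B's input at the fourth corner over `X`
  IMPLIES the skeleton's typed `Cor312Of I` (through the shallow regime: free inequality + archimedean term, NO non-identity
  indeterminacy used); contrapositively (`not_globalVolumeTransport_settingPrVolArchSharp_of_not_cor312Of`) wherever the typed
  Corollary FAILS at a genuine input, TEAM B's input fails at the fourth corner over its pilot data.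
* §4 BOTH SIGNS of the shallow predicate are INHABITED over every number field along abc-iut-w5-d157's synthetic depth family
  `PilotData.deepAt F₀ p l N` (`j_E := p^{−2lN}`, `S := V(F₀)_p`; `ndeg_qDivisor_pilotData_deepAt : deĝ̲(𝔮) = 2lN·log p`):
  `shallow_pilotData_deepAt_iff` (⟺ `(l+4)(l−3)·N·log p ≤ 3(l+5)·log π`), TRUE at `(p,l,N) = (2,5,1)`, FALSE at `(2,5,3)`
  (`shallow_pilotData_deepAt_crosses`), and for every `F₀, p, l` some depth violates it (`exists_pilotData_deepAt_not_shallow`).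

NEUTRAL READING (numbers, not adjectives): at the honest-`∞`, print-normalised corner TEAM B's region-volume input (GAP row
G-c312-11-1) holds EXACTLY in the shallow regime of the `q`-parameter divisor, where the skeleton's typed Corollary at every
genuine input with that pilot data already follows from the free inequality plus `((l+5)/4)·log π`; off that regime (every datum
with `deĝ̲(𝔮) > (50/3)·log π ≈ 19.08`, abc-iut-w5-d241) it is false. So B's route at this corner licenses no datum beyond the
shallow ones. HONEST FRAMING: the `∞`-boxes are this seat's MODEL container; `Cor312Of`/`GlobalVolumeTransport`/`Statement` are
the tree's `Prop`s, asserted here only under the stated hypotheses; nothing here bears on whether [IUTchIII] Thm. 3.11 licenses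
the Corollary; no side taken. typed ≠ proved; instantiated ≠ endorsed.
[cite: Mochizuki2012, IUTchIV Thm 1.10 proof Step (vii) p. 30]; [cite: DupuyHilado2025, Def. 3.1.1, §3.3].
-/

noncomputable section

open Set Function NumberField IsDedekindDomain
open scoped Pointwise

namespace Summit.ABC

namespace IUTFork

namespace Thm311

namespace Real

open Cor312 Cor312Vol Literature.IUT.LogThetaLattice Literature.IUT.LogVolume

/-! ## §1. The fourth-corner inequality ⟺ the shallow regime (pilot-divisor arithmetic) -/

section Shallow

variable {F : Type} [Field F] [NumberField F] (X : PilotData F)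

/-- `((l+1)/24 − 1/(2l))·deĝ̲(𝔮) = deĝ̲_lgp(P_Θ) − deĝ̲(P_q)` (abc-iut-c312-3's `degLgp_thetaPilot_sub_deg_qPilot`, normalised by
`[F:ℚ]`): the skeleton's `κ_l·N` IS the pilot-degree gap. [cite: DupuyHilado2025, Def. 3.1.1, §3.3] -/
theorem kappa_mul_ndeg_qDivisor_eq_gap :
    (((X.l : ℝ) + 1) / 24 - 1 / (2 * (X.l : ℝ))) * FinDivisor.ndeg F X.qDivisor =
      LgpDivisor.ndegLgp X.thetaPilot - FinDivisor.ndeg F X.qPilot := by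
  rw [LgpDivisor.ndegLgp_eq, FinDivisor.ndeg_apply, FinDivisor.ndeg_apply, ← sub_div,
    X.degLgp_thetaPilot_sub_deg_qPilot, mul_div_assoc]

/-- **The archimedean constant of the fourth corner IS abc-iut-S2's `archLogTheta l = ((l+5)/4)·log π`**:
`PN(i ↦ |S^±_{i+2}|·log π) = ((ℓ⋇+3)/2)·log π` (abc-iut-w5-d235 `processionNormalized_card_caps_mul`) and `l = 2ℓ⋇+1`.
[cite: Mochizuki2012, IUTchIV Thm 1.10 proof Step (vii) p. 30] -/
theorem processionNormalized_card_caps_log_pi_eq_archLogTheta :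
    processionNormalized (fun i : Fin (thetaIndex X).lstar =>
        (Fintype.card ((thetaIndex X).Caps (Setting.labelSucc i)) : ℝ) * Real.log Real.pi) =
      ThetaVolumeInput.archLogTheta X.l := by
  rw [processionNormalized_card_caps_mul, ThetaVolumeInput.archLogTheta, X.l_cast]
  ring

/-- **THE FOURTH-CORNER INEQUALITY ⟺ THE SHALLOW REGIME**: abc-iut-c312-7's explicit form of TEAM B's input,
`−deĝ̲(P_q) ≤ −deĝ̲_lgp(P_Θ) + PN(i ↦ |S^±_{i+2}|·log π)`, is EQUIVALENT to `((l+1)/24 − 1/(2l))·deĝ̲(𝔮) ≤ archLogTheta l` —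
literally the hypothesis of abc-iut-skel's `GenuineContent.cor312Of_of_shallow`.
[cite: Mochizuki2012, IUTchIV Thm 1.10 proof Step (vii) p. 30] [claim: Mochizuki2012, status: disputed] -/
theorem archCornerIneq_iff_shallow :
    (-FinDivisor.ndeg F X.qPilot ≤ -LgpDivisor.ndegLgp X.thetaPilot +
        processionNormalized (fun i : Fin (thetaIndex X).lstar =>
          (Fintype.card ((thetaIndex X).Caps (Setting.labelSucc i)) : ℝ) * Real.log Real.pi)) ↔
      (((X.l : ℝ) + 1) / 24 - 1 / (2 * (X.l : ℝ))) * FinDivisor.ndeg F X.qDivisor ≤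
        ThetaVolumeInput.archLogTheta X.l := by
  rw [processionNormalized_card_caps_log_pi_eq_archLogTheta, kappa_mul_ndeg_qDivisor_eq_gap]
  constructor <;> intro h <;> linarith

end Shallow

/-! ## §2. At the fourth-corner setting: TEAM B's input ⟺ the shallow regime -/

variable {F : Type} [Field F] [NumberField F] (X : PilotData F) {logv : PadicLogs F} (hlog : LogvAnalytic logv)
  (hc : ∀ w : InfinitePlace F, w.IsComplex) (M : Type) [Field M] [NumberField M]
  (archPk : ∀ (j : (thetaIndex X).Label) (vQ : (thetaIndex X).VQ), Set ((logShellsDH X logv).Packet j vQ))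
  (archSub : ∀ (j : (thetaIndex X).Label) (v : (thetaIndex X).V),
    Set ((logShellsDH X logv).Packet j ((thetaIndex X).over v)))
  (Ψ : ℤ → ∀ v : (thetaIndex X).V, v ∈ (thetaIndex X).Vbad → Set ((logShellsDH X logv).StarPacket v))
  (act : ℤ → ∀ v : (thetaIndex X).V, v ∈ (thetaIndex X).Vbad →
    (logShellsDH X logv).StarPacket v → Module.End ℚ ((logShellsDH X logv).StarPacket v))
  (Mmod : ℤ → ∀ j : (thetaIndex X).LabelStar, Set ((logShellsDH X logv).GlobalPacket j.1))
  (region : ℤ → ∀ j : (thetaIndex X).LabelStar, FinDivisor M → ∀ vQ : (thetaIndex X).VQ,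
    Set ((logShellsDH X logv).Packet j.1 vQ))
  (n : ℤ) {HT : Type} {LogLink : HT → HT → Type} {IsFull : ∀ {s t : HT}, LogLink s t → Prop}
  (lat : LGPGaussianLogThetaLattice LogLink IsFull)
  {Frd : Type} {IsoF : Frd → Frd → Type} {Ob : Frd → Type} {realify : Frd → Frd} {Strip : Type}
  {IsoS : Strip → Strip → Type} {Mv : ∀ v : (thetaIndex X).V, v ∈ (thetaIndex X).Vbad → Type}
  [∀ v h, Monoid (Mv v h)]
  (sig : GlobalLGPFrobenioidSignature (thetaIndex X).lstar (thetaIndex X).V (· ∈ (thetaIndex X).Vbad)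
    Frd IsoF Ob realify Strip IsoS Mv)
  (split : SplittingMonoids Mv) {ObΔ : Type} {N : ∀ v : (thetaIndex X).V, v ∈ (thetaIndex X).Vbad → Type}
  [∀ v h, Monoid (N v h)] (qData : QPilotData ObΔ N)
  (t : ∀ (pp : Nat.Primes) (_ : Fin X.lstar) (x : (thetaIndex X).Fibre (.inr pp)),
    haveI : Fact (pp : ℕ).Prime := ⟨pp.2⟩; kOf X pp.1 x)
  (tq : ∀ (pp : Nat.Primes) (x : (thetaIndex X).Fibre (.inr pp)), haveI : Fact (pp : ℕ).Prime := ⟨pp.2⟩; kOf X pp.1 x)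
  (ht0 : ∀ pp i x, t pp i x ≠ 0)
  (ht : ∀ (pp : Nat.Primes) (i : Fin X.lstar) (x : (thetaIndex X).Fibre (.inr pp)),
    haveI : Fact (pp : ℕ).Prime := ⟨pp.2⟩
    Real.log ‖t pp i x‖ = -(X.thetaPilot i (placeOf X pp.1 x)) * logNorm F (placeOf X pp.1 x) /
      localDegree F (placeOf X pp.1 x))
  (htq0 : ∀ pp x, tq pp x ≠ 0)
  (htq1 : ∀ (pp : Nat.Primes) (x : (thetaIndex X).Fibre (.inr pp)),
    haveI : Fact (pp : ℕ).Prime := ⟨pp.2⟩; placeOf X pp.1 x ∉ X.S → ‖tq pp x‖ = 1)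

include ht0 ht in
/-- **At the fourth corner, TEAM B's input `GlobalVolumeTransport` ⟺ THE SHALLOW REGIME
`((l+1)/24 − 1/(2l))·deĝ̲(𝔮) ≤ ((l+5)/4)·log π`** (abc-iut-c312-7's `…_iff` composed with §1). [claim: Mochizuki2012, status: disputed]
for the quoted setting; [cite: Mochizuki2012, IUTchIV Thm 1.10 proof Step (vii) p. 30] [cite: DupuyHilado2025, §3.3, Thm. 3.10.1] -/
theorem globalVolumeTransport_settingPrVolArchSharp_iff_shallow
    (htq : ∀ (pp : Nat.Primes) (x : (thetaIndex X).Fibre (.inr pp)),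
      haveI : Fact (pp : ℕ).Prime := ⟨pp.2⟩
      Real.log ‖tq pp x‖ = -(X.qPilot (placeOf X pp.1 x)) * logNorm F (placeOf X pp.1 x) /
        localDegree F (placeOf X pp.1 x)) :
    GlobalVolumeTransport
        (settingPrVolArchSharp X hlog hc M archPk archSub Ψ act Mmod region n lat sig split qData t tq htq0 htq1) ↔
      (((X.l : ℝ) + 1) / 24 - 1 / (2 * (X.l : ℝ))) * FinDivisor.ndeg F X.qDivisor ≤
        ThetaVolumeInput.archLogTheta X.l := by
  rw [globalVolumeTransport_settingPrVolArchSharp_iff X hlog hc M archPk archSub Ψ act Mmod region n lat sig split qData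
      t tq ht0 ht htq0 htq1 htq]
  exact archCornerIneq_iff_shallow X

include ht0 ht in
/-- **Shallow ⟹ the typed Cor. 3.12 `Statement` HOLDS at the fourth corner** (abc-iut-c312-7's
`statement_settingPrVolArchSharp_of_globalVolumeTransport`: hull ⊇ images, monotone volumes; the honest-`∞` container's
`(j+1)·log π` terms pay for the whole degree gap in this regime). A census datum about this seat's archimedean MODEL container,
not about the printed Corollary. [claim: Mochizuki2012, status: disputed] for the quoted setting; [cite: DupuyHilado2025, §3.3, Thm. 3.10.1] -/
theorem statement_settingPrVolArchSharp_of_shallow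
    (ht1 : ∀ (pp : Nat.Primes) (i : Fin X.lstar) (x : (thetaIndex X).Fibre (.inr pp)),
      haveI : Fact (pp : ℕ).Prime := ⟨pp.2⟩; placeOf X pp.1 x ∉ X.S → ‖t pp i x‖ = 1)
    (htq : ∀ (pp : Nat.Primes) (x : (thetaIndex X).Fibre (.inr pp)),
      haveI : Fact (pp : ℕ).Prime := ⟨pp.2⟩
      Real.log ‖tq pp x‖ = -(X.qPilot (placeOf X pp.1 x)) * logNorm F (placeOf X pp.1 x) /
        localDegree F (placeOf X pp.1 x))
    (hshallow : (((X.l : ℝ) + 1) / 24 - 1 / (2 * (X.l : ℝ))) * FinDivisor.ndeg F X.qDivisor ≤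
      ThetaVolumeInput.archLogTheta X.l) :
    (settingPrVolArchSharp X hlog hc M archPk archSub Ψ act Mmod region n lat sig split qData t tq htq0 htq1).Statement :=
  statement_settingPrVolArchSharp_of_globalVolumeTransport X hlog hc M archPk archSub Ψ act Mmod region n lat sig split
    qData t tq ht0 ht1 htq0 htq1
    ((globalVolumeTransport_settingPrVolArchSharp_iff_shallow X hlog hc M archPk archSub Ψ act Mmod region n lat sig split
      qData t tq ht0 ht htq0 htq1 htq).mpr hshallow)

include ht0 ht in
/-- **Deep ⟹ TEAM B's input FAILS at the fourth corner**: if `((l+5)/4)·log π < ((l+1)/24 − 1/(2l))·deĝ̲(𝔮)` then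
`¬ GlobalVolumeTransport` there (the typed `Statement` is then exactly the hull question, untouched).
[claim: Mochizuki2012, status: disputed] for the quoted setting; [cite: DupuyHilado2025, §3.3, Thm. 3.10.1] -/
theorem not_globalVolumeTransport_settingPrVolArchSharp_of_deep
    (htq : ∀ (pp : Nat.Primes) (x : (thetaIndex X).Fibre (.inr pp)),
      haveI : Fact (pp : ℕ).Prime := ⟨pp.2⟩
      Real.log ‖tq pp x‖ = -(X.qPilot (placeOf X pp.1 x)) * logNorm F (placeOf X pp.1 x) /
        localDegree F (placeOf X pp.1 x))
    (hdeep : ThetaVolumeInput.archLogTheta X.l <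
      (((X.l : ℝ) + 1) / 24 - 1 / (2 * (X.l : ℝ))) * FinDivisor.ndeg F X.qDivisor) :
    ¬ GlobalVolumeTransport
        (settingPrVolArchSharp X hlog hc M archPk archSub Ψ act Mmod region n lat sig split qData t tq htq0 htq1) :=
  fun hG => (not_le.mpr hdeep)
    ((globalVolumeTransport_settingPrVolArchSharp_iff_shallow X hlog hc M archPk archSub Ψ act Mmod region n lat sig split
      qData t tq ht0 ht htq0 htq1 htq).mp hG)

/-! ## §3. In the skeleton's currency: TEAM B's input at the fourth corner ⟹ `Cor312Of` at every genuine input with that pilot data -/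

include ht0 ht in
/-- **TEAM B's input at the fourth corner over the pilot data of a GENUINE Θ-volume input `I` forces the skeleton's typed
Corollary `Cor312Of I`** (`−|log(q)| ≤ −|log(Θ)|` for `I`: sharp (Ind3), full (Ind1)/(Ind2), genuine completions, the print's
container `((l+5)/4)·log π`): the input puts `I.X` in the shallow regime, where abc-iut-skel's `GenuineContent.cor312Of_of_shallow`
concludes by the free inequality alone — NO non-identity indeterminacy is used. `I` ranges over EVERY section of places and EVERY
choice of ideles with `I.X = X`. [cite: Mochizuki2012, IUTchIII Cor. 3.12 p. 173–174]
[cite: Mochizuki2012, IUTchIV Thm 1.10 proof Step (vii) p. 30] [claim: Mochizuki2012, status: disputed] -/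
theorem cor312Of_of_globalVolumeTransport_settingPrVolArchSharp
    {K' : Type} [Field K'] [NumberField K'] [Algebra F K'] (I : ThetaVolumeInput F K') (hIX : I.X = X)
    (htq : ∀ (pp : Nat.Primes) (x : (thetaIndex X).Fibre (.inr pp)),
      haveI : Fact (pp : ℕ).Prime := ⟨pp.2⟩
      Real.log ‖tq pp x‖ = -(X.qPilot (placeOf X pp.1 x)) * logNorm F (placeOf X pp.1 x) /
        localDegree F (placeOf X pp.1 x))
    (hG : GlobalVolumeTransport
      (settingPrVolArchSharp X hlog hc M archPk archSub Ψ act Mmod region n lat sig split qData t tq htq0 htq1)) :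
    I.Cor312Of := by
  subst hIX
  exact GenuineContent.cor312Of_of_shallow I
    ((globalVolumeTransport_settingPrVolArchSharp_iff_shallow I.X hlog hc M archPk archSub Ψ act Mmod region n lat sig split
      qData t tq ht0 ht htq0 htq1 htq).mp hG)

include ht0 ht in
/-- **Contrapositive**: wherever the skeleton's typed Corollary FAILS at a genuine Θ-volume input `I`, TEAM B's input FAILS at the
fourth corner over its pilot data — for every choice of the remaining setting binders. B's route at this corner licenses no datum
beyond those where `Cor312Of` already holds by arithmetic. [cite: Mochizuki2012, IUTchIII Cor. 3.12 p. 173–174]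
[claim: Mochizuki2012, status: disputed] -/
theorem not_globalVolumeTransport_settingPrVolArchSharp_of_not_cor312Of
    {K' : Type} [Field K'] [NumberField K'] [Algebra F K'] (I : ThetaVolumeInput F K') (hIX : I.X = X)
    (htq : ∀ (pp : Nat.Primes) (x : (thetaIndex X).Fibre (.inr pp)),
      haveI : Fact (pp : ℕ).Prime := ⟨pp.2⟩
      Real.log ‖tq pp x‖ = -(X.qPilot (placeOf X pp.1 x)) * logNorm F (placeOf X pp.1 x) /
        localDegree F (placeOf X pp.1 x))
    (hI : ¬ I.Cor312Of) :
    ¬ GlobalVolumeTransport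
        (settingPrVolArchSharp X hlog hc M archPk archSub Ψ act Mmod region n lat sig split qData t tq htq0 htq1) :=
  fun hG => hI (cor312Of_of_globalVolumeTransport_settingPrVolArchSharp X hlog hc M archPk archSub Ψ act Mmod region n lat sig
    split qData t tq ht0 ht htq0 htq1 I hIX htq hG)

/-! ## §4. Both signs of the shallow predicate are inhabited: abc-iut-w5-d157's synthetic depth family `PilotData.deepAt` -/

section DepthFamily

variable {F₀ : Type} [Field F₀] [NumberField F₀]
variable (p : ℕ) [hp : Fact p.Prime] (l : ℕ) (hl : l.Prime) (h5 : 5 ≤ l) (N : ℕ) (hN : 0 < N)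

/-- **`deĝ̲(𝔮) = 2lN·log p`** for the synthetic pilot data `j_E := p^{−2lN}`, `S := V(F₀)_p` over ANY number field
(`ord_v(q_v) = 2lN·e_v`, `ln|κ(v)| = f_v·log p`, `Σ_{v | p} e_v f_v = [F₀:ℚ]`; abc-iut-skel's `GenuineContent.ndeg_qDivisor_deepAt`
is the same number read through a Θ-volume input). [cite: DupuyHilado2025, §2.5.4, §3.3, §3.6] -/
theorem ndeg_qDivisor_pilotData_deepAt :
    FinDivisor.ndeg F₀ (PilotData.deepAt F₀ p l hl h5 N hN).qDivisor = 2 * (l : ℝ) * N * Real.log p := by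
  have hfin := FinDivisor.finrank_pos (F := F₀)
  rw [FinDivisor.ndeg_apply, PilotData.deg_qDivisor, div_eq_iff hfin.ne']
  have hsum : (Module.finrank ℚ F₀ : ℝ) = ∑ v ∈ placesOver F₀ p, (localDegree F₀ v : ℝ) := by
    rw [← sum_localDegree (F := F₀) p]
    push_cast
    rfl
  rw [hsum, Finset.mul_sum]
  show ∑ v ∈ placesOver F₀ p, ((PilotData.deepAt F₀ p l hl h5 N hN).ordq v : ℝ) * logNorm F₀ v = _
  refine Finset.sum_congr rfl fun v hv => ?_
  rw [PilotData.deepAt_ordq p l hl h5 N hN v hv, logNorm_eq F₀ v, (mem_placesOver_iff_residueChar v).mp hv,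
    localDegree]
  push_cast
  ring

/-- The shallow predicate along the depth family: ⟺ `(l+4)(l−3)·N·log p ≤ 3(l+5)·log π`
(`((l+1)/24 − 1/(2l))·2lN·log p = ((l+4)(l−3)/12)·N·log p`). [cite: DupuyHilado2025, §3.3] [claim: Mochizuki2012, status: disputed] -/
theorem shallow_pilotData_deepAt_iff :
    (((((PilotData.deepAt F₀ p l hl h5 N hN).l : ℝ) + 1) / 24 -
          1 / (2 * ((PilotData.deepAt F₀ p l hl h5 N hN).l : ℝ))) *
        FinDivisor.ndeg F₀ (PilotData.deepAt F₀ p l hl h5 N hN).qDivisor ≤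
      ThetaVolumeInput.archLogTheta (PilotData.deepAt F₀ p l hl h5 N hN).l) ↔
      ((l : ℝ) + 4) * ((l : ℝ) - 3) * ((N : ℝ) * Real.log p) ≤ 3 * ((l : ℝ) + 5) * Real.log Real.pi := by
  rw [ndeg_qDivisor_pilotData_deepAt, ThetaVolumeInput.archLogTheta]
  change (((l : ℝ) + 1) / 24 - 1 / (2 * (l : ℝ))) * (2 * (l : ℝ) * N * Real.log p) ≤
      ((l : ℝ) + 5) / 4 * Real.log Real.pi ↔ _
  have hl0 : (l : ℝ) ≠ 0 := by exact_mod_cast hl.ne_zero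
  have e1 : (((l : ℝ) + 1) / 24 - 1 / (2 * (l : ℝ))) * (2 * (l : ℝ) * N * Real.log p) =
      (1 / 12 : ℝ) * (((l : ℝ) + 4) * ((l : ℝ) - 3) * ((N : ℝ) * Real.log p)) := by
    field_simp
    ring
  have e2 : ((l : ℝ) + 5) / 4 * Real.log Real.pi = (1 / 12 : ℝ) * (3 * ((l : ℝ) + 5) * Real.log Real.pi) := by ring
  rw [e1, e2]
  exact ⟨fun h => le_of_mul_le_mul_left h (by norm_num), fun h => mul_le_mul_of_nonneg_left h (by norm_num)⟩

/-- `1 < log π` (`exp 1 < 2.72 < 3 < π`). [folklore] -/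
private theorem one_lt_log_pi_aux : 1 < Real.log Real.pi := by
  rw [Real.lt_log_iff_exp_lt Real.pi_pos]
  linarith [Real.exp_one_lt_d9, Real.pi_gt_three]

/-- `log π < 6/5` (`π < 3.15 < 2.718·1.2 ≤ exp 1 · exp (1/5) = exp (6/5)`). [folklore] -/
private theorem log_pi_lt_six_fifths_aux : Real.log Real.pi < 6 / 5 := by
  rw [Real.log_lt_iff_lt_exp Real.pi_pos]
  have h1 := Real.exp_one_gt_d9
  have h2 : (1 : ℝ) / 5 + 1 ≤ Real.exp (1 / 5) := Real.add_one_le_exp _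
  have h3 : Real.exp (6 / 5 : ℝ) = Real.exp 1 * Real.exp (1 / 5) := by
    rw [← Real.exp_add]
    congr 1
    norm_num
  have h4 : (2.7182818283 : ℝ) * ((1 : ℝ) / 5 + 1) ≤ Real.exp 1 * Real.exp (1 / 5) :=
    mul_le_mul h1.le h2 (by norm_num) (Real.exp_pos 1).le
  rw [h3]
  linarith [Real.pi_lt_d2]

/-- **For every base, prime and `l`, SOME depth is deep** (the `q`-side grows linearly in `N`; the archimedean constant does
not move). [cite: DupuyHilado2025, §3.3] [claim: Mochizuki2012, status: disputed] -/
theorem exists_pilotData_deepAt_not_shallow :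
    ∃ (N : ℕ) (hN : 0 < N),
      ¬ (((((PilotData.deepAt F₀ p l hl h5 N hN).l : ℝ) + 1) / 24 -
              1 / (2 * ((PilotData.deepAt F₀ p l hl h5 N hN).l : ℝ))) *
            FinDivisor.ndeg F₀ (PilotData.deepAt F₀ p l hl h5 N hN).qDivisor ≤
          ThetaVolumeInput.archLogTheta (PilotData.deepAt F₀ p l hl h5 N hN).l) := by
  have hc : (0 : ℝ) < ((l : ℝ) + 4) * ((l : ℝ) - 3) * Real.log p := by
    have h5' : (5 : ℝ) ≤ l := by exact_mod_cast h5
    have hlogp : 0 < Real.log p := Real.log_pos (by exact_mod_cast hp.out.one_lt)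
    have h1 : (0 : ℝ) < (l : ℝ) + 4 := by linarith
    have h2 : (0 : ℝ) < (l : ℝ) - 3 := by linarith
    positivity
  obtain ⟨N, hN⟩ :=
    exists_nat_gt (3 * ((l : ℝ) + 5) * Real.log Real.pi / (((l : ℝ) + 4) * ((l : ℝ) - 3) * Real.log p))
  refine ⟨N + 1, Nat.succ_pos N, ?_⟩
  rw [shallow_pilotData_deepAt_iff, not_le]
  rw [div_lt_iff₀ hc] at hN
  push_cast
  nlinarith [hc]

/-- **SHALLOW at `(p, l, N) = (2, 5, 1)`** over every base: `18·log 2 ≤ 30·log π` (compare abc-iut-skel's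
`GenuineContent.cor312Of_deepAt_five_two_one`). [cite: DupuyHilado2025, §3.3] [claim: Mochizuki2012, status: disputed] -/
theorem shallow_pilotData_deepAt_two_five_one :
    ((((PilotData.deepAt F₀ 2 5 Nat.prime_five le_rfl 1 Nat.one_pos).l : ℝ) + 1) / 24 -
          1 / (2 * ((PilotData.deepAt F₀ 2 5 Nat.prime_five le_rfl 1 Nat.one_pos).l : ℝ))) *
        FinDivisor.ndeg F₀ (PilotData.deepAt F₀ 2 5 Nat.prime_five le_rfl 1 Nat.one_pos).qDivisor ≤
      ThetaVolumeInput.archLogTheta (PilotData.deepAt F₀ 2 5 Nat.prime_five le_rfl 1 Nat.one_pos).l := by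
  rw [shallow_pilotData_deepAt_iff]
  push_cast
  nlinarith [Real.log_two_lt_d9, one_lt_log_pi_aux]

/-- **DEEP at `(p, l, N) = (2, 5, 3)`** over every base: `54·log 2 > 37.4 > 36 > 30·log π`.
[cite: DupuyHilado2025, §3.3] [claim: Mochizuki2012, status: disputed] -/
theorem not_shallow_pilotData_deepAt_two_five_three :
    ¬ (((((PilotData.deepAt F₀ 2 5 Nat.prime_five le_rfl 3 (by norm_num)).l : ℝ) + 1) / 24 -
            1 / (2 * ((PilotData.deepAt F₀ 2 5 Nat.prime_five le_rfl 3 (by norm_num)).l : ℝ))) *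
          FinDivisor.ndeg F₀ (PilotData.deepAt F₀ 2 5 Nat.prime_five le_rfl 3 (by norm_num)).qDivisor ≤
        ThetaVolumeInput.archLogTheta (PilotData.deepAt F₀ 2 5 Nat.prime_five le_rfl 3 (by norm_num)).l) := by
  rw [shallow_pilotData_deepAt_iff, not_le]
  push_cast
  nlinarith [Real.log_two_gt_d9, log_pi_lt_six_fifths_aux]

/-- **BOTH SIGNS INHABITED along ONE integer parameter over every number field**: at `(p, l) = (2, 5)` the shallow predicate
(= TEAM B's input at the fourth corner, §2; = the regime where the skeleton's `Cor312Of` holds by arithmetic) is TRUE at some depth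
and FALSE at another. [cite: DupuyHilado2025, §3.3] [claim: Mochizuki2012, status: disputed] -/
theorem shallow_pilotData_deepAt_crosses :
    (∃ (N : ℕ) (hN : 0 < N),
        ((((PilotData.deepAt F₀ 2 5 Nat.prime_five le_rfl N hN).l : ℝ) + 1) / 24 -
              1 / (2 * ((PilotData.deepAt F₀ 2 5 Nat.prime_five le_rfl N hN).l : ℝ))) *
            FinDivisor.ndeg F₀ (PilotData.deepAt F₀ 2 5 Nat.prime_five le_rfl N hN).qDivisor ≤
          ThetaVolumeInput.archLogTheta (PilotData.deepAt F₀ 2 5 Nat.prime_five le_rfl N hN).l) ∧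
      ∃ (N : ℕ) (hN : 0 < N),
        ¬ (((((PilotData.deepAt F₀ 2 5 Nat.prime_five le_rfl N hN).l : ℝ) + 1) / 24 -
                1 / (2 * ((PilotData.deepAt F₀ 2 5 Nat.prime_five le_rfl N hN).l : ℝ))) *
              FinDivisor.ndeg F₀ (PilotData.deepAt F₀ 2 5 Nat.prime_five le_rfl N hN).qDivisor ≤
            ThetaVolumeInput.archLogTheta (PilotData.deepAt F₀ 2 5 Nat.prime_five le_rfl N hN).l) :=
  ⟨⟨1, Nat.one_pos, shallow_pilotData_deepAt_two_five_one⟩,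
    ⟨3, by norm_num, not_shallow_pilotData_deepAt_two_five_three⟩⟩

end DepthFamily

end Real

end Thm311

end IUTFork

end Summit.ABC

end
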